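import Mathlib
import HarnessLib
import Literature.Analysis.FluidPDE.Tao2016AveragedNS.RenormalisedCascadeWaves
import Literature.Analysis.FluidPDE.Tao2016AveragedNS.SelfSimilarCascadeBlowup
import Literature.Analysis.FluidPDE.Tao2016AveragedNS.SelfSimilarCascadeResidues

/-!
# NO SOLITARY WAVES ON THE UNIFORM CONSERVATIVE LATTICE of a Tao-type table — every front leaves a wake
# (helper toward K1ᵛ(1) `TaoLadderRungTwoBreak.NoSurvivingEternalViscBddOne`, stmt-NavierStokesRegularity-20419)

MODEL lattice ODEs only (Tao 2016 §4: the abstract profile systems `IsSWave π Q A B d c₁ c₂ T Φ` over structure maps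
`STable Q A B C_A` of the tree module `RenormalisedCascadeWaves`); nothing here is a statement about the Navier–Stokes equations;
no stub, crux, rung or summit is proved (`--supports stmt-NavierStokesRegularity-20419`).

THE LIMIT OBJECT.  A forward (S₁)-surviving bounded admissible eternal solution at small `ε₀` lives on the scale `W ~ 1/ℓ`,
`σ ~ ℓ` (`ℓ = log(1+ε₀)`; the tree's `1/ε₀` amplitude floor and front-speed bound); in the rescaled variables `V = ℓW`, `s = σ/ℓ`
the renormalised lattice is the `ℓ`-perturbation of the UNIFORM CONSERVATIVE lattice — the profile system with damping `d = 0` and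
equal feed/drain `c₁ = c₂ = c` (docstring of `IsSWave`: «`(d, c₁, c₂) = (0, 1, 1)`: travelling / period-`q` wave of the uniform
lattice»), whose travelling waves are scale-free.  A survivor losing `o(ℓ)` energy per hop would converge to a LOSSLESS PULSE of that
lattice: a wave with integrable (hence, being bounded, square-integrable) summed mass.  This file proves that no such pulse exists,
on ANY table:

* `blockEnergy_uniform_ge` — BLOCK RATCHET for `IsSWave π Q A B 0 c c T Φ` (`c ≥ 0`, `T ≥ 0`): the energy of the block of `J+1`
  consecutive shells `Σ_{j≤J} sEnergy Φ (x + jT)` obeys, for `x₀ ≤ x₁`,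
  `Σ_{j≤J} sEnergy(x₁ + jT) ≥ e^{−2cC_A∫_{x₀}^{x₁} sMass(u−T)du}·Σ_{j≤J} sEnergy(x₀ + jT) − 2cC_A·M_b²·∫_{x₀}^{x₁} sMass(u+(J+1)T)du`
  (`M_b ≥ sup sMass`; with `M_b²` on the rear term): by the cancellation identity the interior fluxes telescope (tree `hasDerivAt_sEnergy`), the front outflow
  is quadratic in the front shell (`abs_sFlux_le`) — a multiplicative loss only — and the rear inflow is controlled by the mass far
  behind;
* `no_pulse_uniform` — **if `c > 0`, `T > 0`, the summed mass is bounded and integrable on `ℝ`, then `Φ ≡ 0`**: averaging the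
  ratchet over one period, `∫_x^{x+T} Σ_{j≤J} sEnergy(· + jT) = ∫_x^{x+(J+1)T} sEnergy ≤ M_b·∫_{x}^{∞} sMass → 0`, while the ratchet
  keeps it `≥ T·e^{−2cC_A‖sMass‖₁}·sEnergy(x₀) − o(1)`.

READING for ⟨20419⟩ (census 4-g12): Tao's cascade structure (outflow of a shell ∝ its own energy × the amplitude ahead) — not
mere nonlinearity (Nesterenko-type lattices do carry solitary waves) — forbids lossless pulses on EVERY table; hence a survivor of
K1ᵛ(1) at small `ε₀` is necessarily an EXTENDED front with an `O(1)`-long wake in `y = nℓ` (or has per-shell action `↗ ∞`), and the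
Liouville statement is the selection problem for such fronts (`…ContinuumCharacteristic`, `…ContinuumSystemSelection`).  With
damping `d > 0` (the actual renormalised lattice) fronts with wakes decaying like `e^{−dx}` ARE integrable, so this theorem is about
the limit object only.  HONEST LABEL: a theorem about model travelling waves; (ρ0), (ρ+), ⟨20419⟩ and every NS statement remain OPEN.
-/

noncomputable section

-- the summit and its single sub-problem share the name (CONVENTIONS §1)
set_option linter.dupNamespace false

namespace Summit.NavierStokesRegularity.NavierStokesRegularity.Theorems.NoSurvivingEternalViscBddOne.UniformLatticeNoPulse

open Set Filter Topology MeasureTheory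
open scoped RealInnerProductSpace
open Literature.Analysis.FluidPDE Literature.Analysis.FluidPDE.TaoCascade

variable {V : Type*} [NormedAddCommGroup V] [InnerProductSpace ℝ V]
variable {ρ : Type*} [Fintype ρ]
variable {π : Equiv.Perm ρ} {Q A : V → V} {B : V → V → V} {CA c T : ℝ} {Φ : ρ → ℝ → V}

/-! ## §1 Pointwise bounds -/

omit [InnerProductSpace ℝ V] in
/-- `sEnergy ≤ M_b · sMass` when `sMass ≤ M_b` (each `‖Φ_r‖ ≤ sMass ≤ M_b`).
[cite: Tao2016AveragedNS, §4 Lemma 4.1 (4.8)–(4.10); elementary] -/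
theorem sEnergy_le_mul_sMass {Mb : ℝ} (hMb : ∀ x, sMass Φ x ≤ Mb) (x : ℝ) : sEnergy Φ x ≤ Mb * sMass Φ x := by
  unfold sEnergy
  have h : ∀ r ∈ (Finset.univ : Finset ρ), ‖Φ r x‖ ^ 2 ≤ Mb * ‖Φ r x‖ := by
    intro r _
    have h1 : ‖Φ r x‖ ≤ Mb := (norm_le_sMass Φ x r).trans (hMb x)
    rw [sq]; exact mul_le_mul_of_nonneg_right h1 (norm_nonneg _)
  calc ∑ r, ‖Φ r x‖ ^ 2 ≤ ∑ r, Mb * ‖Φ r x‖ := Finset.sum_le_sum h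
    _ = Mb * sMass Φ x := by unfold sMass; rw [Finset.mul_sum]

omit [InnerProductSpace ℝ V] in
/-- The block energy dominates its front shell: `sEnergy(x) ≤ Σ_{j≤J} sEnergy(x + jT)`.
[cite: Tao2016AveragedNS, §4 Lemma 4.1 (4.10); elementary] -/
theorem sEnergy_le_block (Φ : ρ → ℝ → V) (T : ℝ) (J : ℕ) (x : ℝ) :
    sEnergy Φ x ≤ ∑ j ∈ Finset.range (J + 1), sEnergy Φ (x + j * T) := by
  have hmem : 0 ∈ Finset.range (J + 1) := Finset.mem_range.2 (Nat.succ_pos J)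
  have h := Finset.single_le_sum (s := Finset.range (J + 1)) (f := fun j : ℕ => sEnergy Φ (x + j * T))
    (fun j _ => sEnergy_nonneg Φ _) hmem
  simpa using h

/-! ## §2 The block ratchet on the uniform conservative lattice -/

/-- **Derivative of the block energy** on the lattice `d = 0`, `c₁ = c₂ = c`: the interior fluxes telescope,
`(Σ_{j≤J} sEnergy(· + jT))'(x) = 2c·sFlux(x + (J+1)T) − 2c·sFlux(x)` (rear inflow minus front outflow).
[cite: Tao2016AveragedNS, §4 (4.2)–(4.3), Lemma 4.1 (4.8)–(4.10); tree `hasDerivAt_sEnergy`] -/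
theorem hasDerivAt_blockEnergy_uniform (hS : STable Q A B CA) (hΦ : IsSWave π Q A B 0 c c T Φ) (J : ℕ) (x : ℝ) :
    HasDerivAt (fun y => ∑ j ∈ Finset.range (J + 1), sEnergy Φ (y + j * T))
      (2 * c * sFlux π A T Φ (x + (J + 1 : ℕ) * T) - 2 * c * sFlux π A T Φ x) x := by
  have hj : ∀ j : ℕ, HasDerivAt (fun y => sEnergy Φ (y + j * T))
      (2 * c * sFlux π A T Φ (x + (j + 1 : ℕ) * T) - 2 * c * sFlux π A T Φ (x + j * T)) x := by
    intro j
    have h := (hasDerivAt_sEnergy hS hΦ (x + j * T)).comp_add_const x (j * T)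
    refine h.congr_deriv ?_
    have e : x + (j : ℝ) * T + T = x + ((j + 1 : ℕ) : ℝ) * T := by push_cast; ring
    rw [e]; ring
  have h := HasDerivAt.fun_sum (u := Finset.range (J + 1)) fun j _ => hj j
  refine h.congr_deriv ?_
  have tele : ∀ K : ℕ, ∑ j ∈ Finset.range (K + 1),
      (2 * c * sFlux π A T Φ (x + ((j + 1 : ℕ) : ℝ) * T) - 2 * c * sFlux π A T Φ (x + (j : ℝ) * T))
      = 2 * c * sFlux π A T Φ (x + ((K + 1 : ℕ) : ℝ) * T) - 2 * c * sFlux π A T Φ x := by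
    intro K
    induction K with
    | zero => simp
    | succ K ih => rw [Finset.sum_range_succ, ih]; ring
  exact tele J

/-- **THE BLOCK RATCHET on the uniform conservative lattice.**  For `IsSWave π Q A B 0 c c T Φ` (`c ≥ 0`) with `sMass ≤ M_b`,
`x₀ ≤ x₁` and any `J`: `e^{−2cC_A∫_{x₀}^{x₁}sMass(u−T)du}·Σ_{j≤J}sEnergy(x₀+jT) − 2cC_A·M_b²·∫_{x₀}^{x₁}sMass(u+(J+1)T)du
≤ Σ_{j≤J}sEnergy(x₁+jT)`: the block loses energy forward only at a rate proportional to its own content (outflow quadratic in the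
front shell, `abs_sFlux_le`), so it never empties through the front; what enters or leaves at the rear is bounded by the mass there.
[cite: Tao2016AveragedNS, §4 (4.2)–(4.3), Lemma 4.1 (4.8)–(4.10); this file] -/
theorem blockEnergy_uniform_ge (hS : STable Q A B CA) (hΦ : IsSWave π Q A B 0 c c T Φ) (hc : 0 ≤ c)
    {Mb : ℝ} (hMb : ∀ x, sMass Φ x ≤ Mb) (J : ℕ) {x₀ x₁ : ℝ} (hle : x₀ ≤ x₁) :
    Real.exp (-(2 * c * CA * ∫ u in x₀..x₁, sMass Φ (u - T)))
        * (∑ j ∈ Finset.range (J + 1), sEnergy Φ (x₀ + j * T))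
        - 2 * c * CA * Mb ^ 2 * ∫ u in x₀..x₁, sMass Φ (u + (J + 1 : ℕ) * T)
      ≤ ∑ j ∈ Finset.range (J + 1), sEnergy Φ (x₁ + j * T) := by
  have hCA : 0 ≤ CA := hS.CA_nonneg
  have hMb0 : 0 ≤ Mb := (sMass_nonneg Φ 0).trans (hMb 0)
  set Tb : ℝ → ℝ := fun y => ∑ j ∈ Finset.range (J + 1), sEnergy Φ (y + j * T) with hTb
  have hTnn : ∀ y, 0 ≤ Tb y := fun y => Finset.sum_nonneg fun j _ => sEnergy_nonneg Φ _
  have cM : Continuous (sMass Φ) := hΦ.continuous_sMass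
  have cF : Continuous (sFlux π A T Φ) := hΦ.continuous_sFlux hS
  -- rate and primitive
  set θ : ℝ → ℝ := fun u => 2 * c * CA * sMass Φ (u - T) with hθ
  have cθ : Continuous θ := by simp only [hθ]; fun_prop
  have hθnn : ∀ u, 0 ≤ θ u := fun u => by simp only [hθ]; have := sMass_nonneg Φ (u - T); positivity
  set P : ℝ → ℝ := fun u => ∫ v in x₀..u, θ v with hP
  have hPderiv : ∀ u, HasDerivAt P (θ u) u := fun u => (cθ.integral_hasStrictDerivAt x₀ u).hasDerivAt
  have cP : Continuous P := continuous_iff_continuousAt.2 fun u => (hPderiv u).continuousAt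
  have hP0 : P x₀ = 0 := by simp [hP]
  have hPmono : ∀ s ∈ Icc x₀ x₁, P s ≤ P x₁ := by
    intro s hs
    have h := intervalIntegral.integral_mono_interval (μ := volume) (f := θ) (c := x₀) (d := x₁) (a := x₀)
      (b := s) le_rfl hs.1 hs.2 (Eventually.of_forall fun v => hθnn v) (cθ.intervalIntegrable _ _)
    simpa [hP] using h
  have hPx₁ : P x₁ = 2 * c * CA * ∫ u in x₀..x₁, sMass Φ (u - T) := by
    simp only [hP, hθ]; rw [intervalIntegral.integral_const_mul]
  -- derivative of the block
  set D : ℝ → ℝ := fun u => 2 * c * sFlux π A T Φ (u + (J + 1 : ℕ) * T) - 2 * c * sFlux π A T Φ u with hD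
  have hTderiv : ∀ u, HasDerivAt Tb (D u) u := fun u => hasDerivAt_blockEnergy_uniform hS hΦ J u
  have cD : Continuous D := by simp only [hD]; fun_prop
  set Ψ : ℝ → ℝ := fun u => Real.exp (P u) * Tb u with hΨ
  set Ψ' : ℝ → ℝ := fun u => Real.exp (P u) * θ u * Tb u + Real.exp (P u) * D u with hΨ'
  have hΨderiv : ∀ u, HasDerivAt Ψ (Ψ' u) u := fun u => (hPderiv u).exp.mul (hTderiv u)
  have cTb : Continuous Tb := continuous_iff_continuousAt.2 fun u => (hTderiv u).continuousAt
  have cΨ' : Continuous Ψ' := by have : Continuous fun u => Real.exp (P u) := cP.rexp; simp only [hΨ']; fun_prop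
  -- the rear term
  set r : ℝ → ℝ := fun u => 2 * c * CA * Mb ^ 2 * sMass Φ (u + (J + 1 : ℕ) * T) with hr
  have cr : Continuous r := by simp only [hr]; fun_prop
  set G : ℝ → ℝ := fun u => -(Real.exp (P x₁) * r u) with hG
  have cG : Continuous G := by simp only [hG]; fun_prop
  have hlow : ∀ u ∈ Icc x₀ x₁, G u ≤ Ψ' u := by
    intro u hu
    have heP : 0 < Real.exp (P u) := Real.exp_pos _
    have hePle : Real.exp (P u) ≤ Real.exp (P x₁) := Real.exp_le_exp.2 (hPmono u hu)
    have hTu := hTnn u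
    have hr0 : 0 ≤ r u := by simp only [hr]; have := sMass_nonneg Φ (u + (J + 1 : ℕ) * T); positivity
    -- front outflow `2c·sFlux(u) ≤ 2c·C_A·sMass(u−T)·sEnergy(u) ≤ θ(u)·Tb(u)`
    have hout : 2 * c * sFlux π A T Φ u ≤ θ u * Tb u := by
      have h1 := (le_abs_self _).trans (abs_sFlux_le hS π T Φ u)
      have h2 : CA * sEnergy Φ u * sMass Φ (u - T) ≤ CA * sMass Φ (u - T) * Tb u := by
        have := sEnergy_le_block Φ T J u
        have hm := sMass_nonneg Φ (u - T)
        nlinarith [mul_le_mul_of_nonneg_left this (mul_nonneg hCA hm)]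
      simp only [hθ]
      nlinarith [mul_le_mul_of_nonneg_left (h1.trans h2) (by positivity : (0 : ℝ) ≤ 2 * c)]
    -- rear inflow `2c·sFlux(u+(J+1)T) ≥ −r(u)`
    have hin : -r u ≤ 2 * c * sFlux π A T Φ (u + (J + 1 : ℕ) * T) := by
      have h1 := (neg_abs_le _).trans' (neg_le_neg (abs_sFlux_le hS π T Φ (u + (J + 1 : ℕ) * T)))
      have h2 : CA * sEnergy Φ (u + (J + 1 : ℕ) * T) * sMass Φ (u + (J + 1 : ℕ) * T - T)
          ≤ CA * Mb ^ 2 * sMass Φ (u + (J + 1 : ℕ) * T) := by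
        have hE := sEnergy_le_mul_sMass hMb (u + (J + 1 : ℕ) * T)
        have hm := hMb (u + (J + 1 : ℕ) * T - T)
        have hm0 := sMass_nonneg Φ (u + (J + 1 : ℕ) * T - T)
        have hs0 := sMass_nonneg Φ (u + (J + 1 : ℕ) * T)
        calc CA * sEnergy Φ (u + (J + 1 : ℕ) * T) * sMass Φ (u + (J + 1 : ℕ) * T - T)
            ≤ CA * (Mb * sMass Φ (u + (J + 1 : ℕ) * T)) * Mb :=
              mul_le_mul (mul_le_mul_of_nonneg_left hE hCA) hm hm0 (by positivity)
          _ = CA * Mb ^ 2 * sMass Φ (u + (J + 1 : ℕ) * T) := by ring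
      simp only [hr]
      nlinarith [mul_le_mul_of_nonneg_left h2 (by positivity : (0 : ℝ) ≤ 2 * c)]
    have hsum : -r u ≤ θ u * Tb u + D u := by simp only [hD]; linarith
    have h3 : Real.exp (P u) * (-r u) ≤ Real.exp (P u) * (θ u * Tb u + D u) :=
      mul_le_mul_of_nonneg_left hsum heP.le
    have h4 : Real.exp (P u) * r u ≤ Real.exp (P x₁) * r u := mul_le_mul_of_nonneg_right hePle hr0
    simp only [hG, hΨ']; nlinarith
  have hftc : ∫ u in x₀..x₁, Ψ' u = Ψ x₁ - Ψ x₀ :=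
    intervalIntegral.integral_eq_sub_of_hasDerivAt (fun u _ => hΨderiv u) (cΨ'.intervalIntegrable _ _)
  have hmono : ∫ u in x₀..x₁, G u ≤ ∫ u in x₀..x₁, Ψ' u :=
    intervalIntegral.integral_mono_on hle (cG.intervalIntegrable _ _) (cΨ'.intervalIntegrable _ _) hlow
  have hGint : ∫ u in x₀..x₁, G u
      = -(Real.exp (P x₁) * (2 * c * CA * Mb ^ 2 * ∫ u in x₀..x₁, sMass Φ (u + (J + 1 : ℕ) * T))) := by
    simp only [hG, hr]; rw [intervalIntegral.integral_neg, intervalIntegral.integral_const_mul,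
      intervalIntegral.integral_const_mul]
  set Rr : ℝ := 2 * c * CA * Mb ^ 2 * ∫ u in x₀..x₁, sMass Φ (u + (J + 1 : ℕ) * T) with hRr
  have hΨ0 : Ψ x₀ = Tb x₀ := by simp [hΨ, hP0]
  have hΨ1 : Ψ x₁ = Real.exp (P x₁) * Tb x₁ := rfl
  have hkey : Tb x₀ - Real.exp (P x₁) * Rr ≤ Real.exp (P x₁) * Tb x₁ := by
    rw [← hΨ1, ← hΨ0]; rw [hGint] at hmono; linarith
  have hdiv : Real.exp (-P x₁) * Tb x₀ - Rr ≤ Tb x₁ := by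
    have h := mul_le_mul_of_nonneg_left hkey (Real.exp_pos (-P x₁)).le
    have e1 : Real.exp (-P x₁) * Real.exp (P x₁) = 1 := by rw [← Real.exp_add, neg_add_cancel, Real.exp_zero]
    have e2 : Real.exp (-P x₁) * (Real.exp (P x₁) * Tb x₁) = Tb x₁ := by rw [← mul_assoc, e1, one_mul]
    have e3 : Real.exp (-P x₁) * (Tb x₀ - Real.exp (P x₁) * Rr) = Real.exp (-P x₁) * Tb x₀ - Rr := by
      calc Real.exp (-P x₁) * (Tb x₀ - Real.exp (P x₁) * Rr)
          = Real.exp (-P x₁) * Tb x₀ - (Real.exp (-P x₁) * Real.exp (P x₁)) * Rr := by ring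
        _ = _ := by rw [e1, one_mul]
    rwa [e2, e3] at h
  rw [hPx₁] at hdiv
  exact hdiv

/-! ## §3 No pulse -/

/-- Averaging the block over one period: `∫_x^{x+T} Σ_{j≤J} sEnergy(x₁ + jT) dx₁ = ∫_x^{x+(J+1)T} sEnergy`.
[cite: Tao2016AveragedNS, §4 Lemma 4.1 (4.10); elementary] -/
theorem integral_block_eq (hΦ : IsSWave π Q A B 0 c c T Φ) (J : ℕ) (x : ℝ) :
    ∫ x₁ in x..x + T, ∑ j ∈ Finset.range (J + 1), sEnergy Φ (x₁ + j * T)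
      = ∫ u in x..x + (J + 1 : ℕ) * T, sEnergy Φ u := by
  have cE : Continuous (sEnergy Φ) := hΦ.continuous_sEnergy
  have hint : ∀ j ∈ Finset.range (J + 1),
      IntervalIntegrable (fun x₁ : ℝ => sEnergy Φ (x₁ + j * T)) volume x (x + T) := by
    intro j _
    have : Continuous fun x₁ : ℝ => sEnergy Φ (x₁ + j * T) := cE.comp (by fun_prop)
    exact this.intervalIntegrable _ _
  rw [intervalIntegral.integral_finsetSum hint]
  have hshift : ∀ j : ℕ, ∫ x₁ in x..x + T, sEnergy Φ (x₁ + j * T)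
      = ∫ u in (x + j * T)..(x + (j + 1 : ℕ) * T), sEnergy Φ u := by
    intro j
    rw [intervalIntegral.integral_comp_add_right]
    congr 1; push_cast; ring
  simp_rw [hshift]
  have h := intervalIntegral.sum_integral_adjacent_intervals (f := sEnergy Φ) (μ := volume)
    (a := fun k : ℕ => x + (k : ℝ) * T) (n := J + 1) (fun k _ => cE.intervalIntegrable _ _)
  simp only [Nat.cast_zero, zero_mul, add_zero] at h
  rw [← h]

/-- **NO SOLITARY WAVE ON THE UNIFORM CONSERVATIVE LATTICE.**  Let `Q, A, B` be structure maps of Tao type (`STable Q A B C_A`) and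
`Φ` a profile family solving the uniform conservative profile system `IsSWave π Q A B 0 c c T Φ` with `c > 0`, `T > 0`.  If the
summed mass `sMass Φ` is bounded and integrable on `ℝ` (a PULSE: every shell starts and ends empty and has finite action), then
`Φ ≡ 0`.  Every non-trivial travelling / DSS wave of the uniform lattice leaves a wake (non-integrable mass), on EVERY table.
[cite: Tao2016AveragedNS, §4 (4.2)–(4.3), Lemma 4.1 (4.8)–(4.10); this file] -/
theorem no_pulse_uniform (hS : STable Q A B CA) (hΦ : IsSWave π Q A B 0 c c T Φ) (hc : 0 < c) (hT : 0 < T)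
    {Mb : ℝ} (hMb : ∀ x, sMass Φ x ≤ Mb) (hint : Integrable (sMass Φ)) (r : ρ) (x₀ : ℝ) : Φ r x₀ = 0 := by
  have hCA : 0 ≤ CA := hS.CA_nonneg
  have hMb0 : 0 ≤ Mb := (sMass_nonneg Φ 0).trans (hMb 0)
  have cM : Continuous (sMass Φ) := hΦ.continuous_sMass
  have cE : Continuous (sEnergy Φ) := hΦ.continuous_sEnergy
  -- the tail `∫_{Ioi y} sMass → 0`
  set tail : ℝ → ℝ := fun y => ∫ u in Ioi y, sMass Φ u with htail
  have htail0 : Tendsto tail atTop (𝓝 0) := by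
    simp only [htail]; exact MeasureTheory.tendsto_integral_Ioi_zero tendsto_id
  have htail_nn : ∀ y, 0 ≤ tail y := fun y => setIntegral_nonneg measurableSet_Ioi fun u _ => sMass_nonneg Φ u
  -- interval integrals of `sMass` are bounded by tails / by the total action
  have hII : ∀ a b : ℝ, a ≤ b → ∫ u in a..b, sMass Φ u ≤ tail a := by
    intro a b hab
    rw [intervalIntegral.integral_of_le hab]
    exact setIntegral_mono_set hint.integrableOn (Eventually.of_forall fun u => sMass_nonneg Φ u)
      (Eventually.of_forall Ioc_subset_Ioi_self)
  set 𝒜 : ℝ := ∫ u, sMass Φ u with h𝒜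
  have hIA : ∀ a b : ℝ, a ≤ b → ∫ u in a..b, sMass Φ u ≤ 𝒜 := by
    intro a b hab
    rw [intervalIntegral.integral_of_le hab]
    exact setIntegral_le_integral hint (Eventually.of_forall fun u => sMass_nonneg Φ u)
  -- the constant `κ = e^{-2cC_A𝒜}`
  set κ : ℝ := Real.exp (-(2 * c * CA * 𝒜)) with hκ
  have hκ0 : 0 < κ := Real.exp_pos _
  -- main inequality: for x ≥ x₀ and every J, `T κ sEnergy(x₀) ≤ Mb·tail(x) + T·2cC_A·Mb·tail(x₀ + (J+1)T)`
  have hmain : ∀ x : ℝ, x₀ ≤ x → ∀ J : ℕ,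
      T * (κ * sEnergy Φ x₀) ≤ Mb * tail x + T * (2 * c * CA * Mb ^ 2 * tail (x₀ + (J + 1 : ℕ) * T)) := by
    intro x hx J
    -- pointwise ratchet for x₁ ∈ [x, x+T]
    have hpt : ∀ x₁ ∈ Icc x (x + T),
        κ * sEnergy Φ x₀ - 2 * c * CA * Mb ^ 2 * tail (x₀ + (J + 1 : ℕ) * T)
          ≤ ∑ j ∈ Finset.range (J + 1), sEnergy Φ (x₁ + j * T) := by
      intro x₁ hx₁
      have h01 : x₀ ≤ x₁ := hx.trans hx₁.1
      have h := blockEnergy_uniform_ge hS hΦ hc.le hMb J h01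
      -- compare the exponential factors and the rear terms
      have hexp : κ ≤ Real.exp (-(2 * c * CA * ∫ u in x₀..x₁, sMass Φ (u - T))) := by
        rw [hκ]; refine Real.exp_le_exp.2 (neg_le_neg ?_)
        refine mul_le_mul_of_nonneg_left ?_ (by positivity)
        rw [intervalIntegral.integral_comp_sub_right]; exact hIA _ _ (by linarith)
      have hblock0 : sEnergy Φ x₀ ≤ ∑ j ∈ Finset.range (J + 1), sEnergy Φ (x₀ + j * T) := sEnergy_le_block Φ T J x₀
      have hrear : ∫ u in x₀..x₁, sMass Φ (u + (J + 1 : ℕ) * T) ≤ tail (x₀ + (J + 1 : ℕ) * T) := by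
        rw [intervalIntegral.integral_comp_add_right]; exact hII _ _ (by linarith)
      have hE0 := sEnergy_nonneg Φ x₀
      have hB0 : 0 ≤ ∑ j ∈ Finset.range (J + 1), sEnergy Φ (x₀ + j * T) :=
        Finset.sum_nonneg fun j _ => sEnergy_nonneg Φ _
      have hcoef : 0 ≤ 2 * c * CA * Mb ^ 2 := by positivity
      nlinarith [mul_le_mul hexp hblock0 hE0 (Real.exp_pos _).le, mul_le_mul_of_nonneg_left hrear hcoef]
    -- integrate over [x, x+T]
    have hxT : x ≤ x + T := by linarith
    have cB : Continuous fun x₁ : ℝ => ∑ j ∈ Finset.range (J + 1), sEnergy Φ (x₁ + j * T) :=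
      continuous_finsetSum _ fun j _ => (cE.comp (by fun_prop) : Continuous fun x₁ : ℝ => sEnergy Φ (x₁ + j * T))
    have hmono := intervalIntegral.integral_mono_on (μ := volume) hxT
      ((continuous_const : Continuous fun _ : ℝ =>
        κ * sEnergy Φ x₀ - 2 * c * CA * Mb ^ 2 * tail (x₀ + (J + 1 : ℕ) * T)).intervalIntegrable _ _)
      (cB.intervalIntegrable _ _) hpt
    rw [intervalIntegral.integral_const, integral_block_eq hΦ J x] at hmono
    have hup : ∫ u in x..x + (J + 1 : ℕ) * T, sEnergy Φ u ≤ Mb * tail x := by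
      have hxe : x ≤ x + (J + 1 : ℕ) * T := by
        have : (0 : ℝ) ≤ ((J + 1 : ℕ) : ℝ) * T := by positivity
        linarith
      calc ∫ u in x..x + (J + 1 : ℕ) * T, sEnergy Φ u ≤ ∫ u in x..x + (J + 1 : ℕ) * T, Mb * sMass Φ u :=
            intervalIntegral.integral_mono_on hxe (cE.intervalIntegrable _ _)
              ((continuous_const.mul cM).intervalIntegrable _ _) fun u _ => sEnergy_le_mul_sMass hMb u
        _ = Mb * ∫ u in x..x + (J + 1 : ℕ) * T, sMass Φ u := intervalIntegral.integral_const_mul _ _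
        _ ≤ Mb * tail x := mul_le_mul_of_nonneg_left (hII _ _ hxe) hMb0
    have e : (x + T - x) • (κ * sEnergy Φ x₀ - 2 * c * CA * Mb ^ 2 * tail (x₀ + (J + 1 : ℕ) * T))
        = T * (κ * sEnergy Φ x₀) - T * (2 * c * CA * Mb ^ 2 * tail (x₀ + (J + 1 : ℕ) * T)) := by
      rw [smul_eq_mul]; ring
    rw [e] at hmono
    linarith
  -- let the tails go to zero
  have hE0 := sEnergy_nonneg Φ x₀
  have hzero : sEnergy Φ x₀ = 0 := by
    by_contra hne
    have hpos : 0 < sEnergy Φ x₀ := lt_of_le_of_ne hE0 (Ne.symm hne)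
    set δ : ℝ := T * (κ * sEnergy Φ x₀) / (2 * (Mb + T * (2 * c * CA * Mb ^ 2) + 1)) with hδ
    have hden : 0 < Mb + T * (2 * c * CA * Mb ^ 2) + 1 := by positivity
    have hδ0 : 0 < δ := by rw [hδ]; positivity
    have hev : ∀ᶠ y in atTop, tail y < δ := (tendsto_order.1 htail0).2 δ hδ0
    obtain ⟨y₀, hy₀⟩ := Filter.eventually_atTop.1 hev
    -- choose `x ≥ max x₀ y₀` and `J` with `x₀ + (J+1)T ≥ y₀`
    obtain ⟨J, hJ⟩ := exists_nat_gt ((y₀ - x₀) / T)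
    have hJT : y₀ ≤ x₀ + (J + 1 : ℕ) * T := by
      have h1 : (y₀ - x₀) / T * T = y₀ - x₀ := div_mul_cancel₀ _ hT.ne'
      have h2 : (J : ℝ) ≤ ((J + 1 : ℕ) : ℝ) := by push_cast; linarith
      nlinarith [mul_le_mul_of_nonneg_right (hJ.le.trans h2) hT.le]
    have h := hmain (max x₀ y₀) (le_max_left _ _) J
    have ht1 : tail (max x₀ y₀) < δ := hy₀ _ (le_max_right _ _)
    have ht2 : tail (x₀ + (J + 1 : ℕ) * T) < δ := hy₀ _ hJT
    have hTc : 0 ≤ T * (2 * c * CA * Mb ^ 2) := by positivity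
    have hlt : T * (κ * sEnergy Φ x₀) < (Mb + T * (2 * c * CA * Mb ^ 2) + 1) * δ := by
      nlinarith [mul_le_mul_of_nonneg_left ht1.le hMb0, mul_le_mul_of_nonneg_left ht2.le hTc]
    have hδeq : (Mb + T * (2 * c * CA * Mb ^ 2) + 1) * δ = T * (κ * sEnergy Φ x₀) / 2 := by
      rw [hδ]; field_simp
    rw [hδeq] at hlt
    have : 0 < T * (κ * sEnergy Φ x₀) := by positivity
    linarith
  exact eq_zero_of_sEnergy_eq_zero hzero r

end Summit.NavierStokesRegularity.NavierStokesRegularity.Theorems.NoSurvivingEternalViscBddOne.UniformLatticeNoPulse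

end
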